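import Summits.BirchSwinnertonDyer.BirchSwinnertonDyer.Theorems.BiquadraticEisensteinDescentControlCMInertBadAdmOtherAdditiveCount
import Summits.BirchSwinnertonDyer.BirchSwinnertonDyer.Theorems.EisensteinPrimesBSDpOnCellCLogSymmetry
import Summits.BirchSwinnertonDyer.Rank1Residual.X11b.BDPRouteOnTreeStepL
import Summits.BirchSwinnertonDyer.Rank1Residual.X12.CMIrreducible
import Literature.NumberTheory.EllipticCurves.ComplexMultiplicationNotSemistable
import HarnessLib

/-!
# Route `BiquadraticEisensteinDescent`, crux C′ (stmt-BirchSwinnertonDyer-20454): the two restatement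
# shapes of C′ BY VALUE — no `Theses` import, survives any re-render of the route file (file 3)

Seat `bsd-wall-bed-p3` (prover, cell `bsd-wall`). Theorems only; no definition, no named fact, no `sorry`.
Companion of `…ControlCMInertBadAdmOther.lean` (p523934), which concludes the route decl
`Theses.BiquadraticEisensteinDescent.ControlCMInertBadAdmOther` BY NAME and therefore dies if a later
revision drops that decl (TYPING-CHECKLIST T9; the W♭ precedent `…KatzWaldspurgerFrameCMInertBadFlatBody.w9`).
Here the same two theorems are stated BY VALUE — the texts are EXACTLY the two restatements proposed to
the route planner (HOME/bsd-wall-bed-p3/C-OfGZK.sig sha16 73c32ff8b8d2ca5e, C-OfRankOne.sig sha16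
d3436fa05117d46b), so that after the β-C′ restatement the closer is the one-liner
`theorem <NewDecl>_proof : <NewDecl> := ControlCMInertBadAdmOtherBody.c9A` (resp. `c9B`).

* `c9B` — C′ verbatim with `(W.baseChange K).mordellWeilRank = 1 → (W.baseChange K).ShaFinite →
  ¬ IsOfFinAddOrder P →` inserted after `¬ (p : ℤ) ∣ Dt.c →` (fact-free): the kernel
  `…AdditiveCount.additiveSelmerCardBoundTorsion_of_rankOne` + `…exists_hasCharValuationAt_le_of_selmerCardBound_torsion`
  at the strict prime `𝔭′`, CM inputs (`not_mult_of_hasCM`, `X12.irr_of_not_cmRamified`,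
  `Transvection.forall_torsion_eq_zero_of_irr`, `degreeOne_of_splitsIn`) and the log-embedding symmetry
  `LogSymmetry.padicLogOrd_eq_of_finrank_eq_two`.
* `c9A` — `(∀ N W K, gross_zagier N W K) → (∀ N W K, kolyvagin N W K) → hasEntireLFunction_rat →` C′ verbatim
  (conjuncts 1, 2, 5 of the route's `PublishedInputsBiquadratic`): `c9B` + non-torsion of the Heegner point
  (`X11b.not_isOfFinAddOrder_of_heegner_of_analyticRank_eq_one`) + Kolyvagin.

CONDITIONAL only through the displayed antecedents; nothing booked; no label moves.
References: [JetchevSkinnerWan2017] Thm. 3.3.1, §7.4.1 (arXiv:1512.06894 pp. 11, 30); [GreenbergLNM1716] §3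
Lemma 3.3, §4 Lemma 4.2; [Gross1991] (1.1), Thm. 1.3; [Kolyvagin1990] Thm. A; [Mazur1978] §6 Prop. 6.3 (1).
-/

noncomputable section

open scoped Classical

open WeierstrassCurve NumberField IsDedekindDomain Field
open Literature.NumberTheory.EllipticCurves Literature.NumberTheory.EllipticCurves.Rank1Residual
  Summit.BirchSwinnertonDyer.Rank1Residual
  Summit.BirchSwinnertonDyer.Rank1Residual.X11b
  Summit.BirchSwinnertonDyer.Rank1Residual.X11b.AcSelmer
  Summit.BirchSwinnertonDyer.BirchSwinnertonDyer.Theorems.BiquadraticEisensteinDescentControlCMInertBadAdmOtherAdditiveCount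

set_option linter.dupNamespace false

namespace Summit.BirchSwinnertonDyer.BirchSwinnertonDyer.Theorems.ControlCMInertBadAdmOtherBody

/-- **C′ restated, variant B (fact-free), BY VALUE** — text = HOME/bsd-wall-bed-p3/C-OfRankOne.sig
(sha16 d3436fa05117d46b): the crux `ControlCMInertBadAdmOther` verbatim with
`rank_ℤ E(K) = 1 → Ш(E/K) finite → P non-torsion →` after `¬ (p : ℤ) ∣ Dt.c →`. Proof: the additive
torsion-weighted Selmer count and the control count of file 1 at the strict prime `𝔭′` (additive at `p`:
`not_mult_of_hasCM`; `E(K)[p] = 0`: `X12.irr_of_not_cmRamified`; `p` split by the Heegner hypothesis),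
then `ord_p log_{𝔭′} P = ord_p log_𝔭 P` (rank one). [cite: JetchevSkinnerWan2017, Thm. 3.3.1 and §7.4.1 (arXiv:1512.06894 pp. 11, 30)]
[cite: GreenbergLNM1716, §3 Lemma 3.3, §4 Lemma 4.2] [cite: Mazur1978, §6 Prop. 6.3 (1) (p. 153)] -/
theorem c9B :
    ∀ (W : WeierstrassCurve ℚ) [W.IsElliptic] [W.IsGloballyMinimal] (p : ℕ) [Fact p.Prime] [NeZero (W.conductorNorm ℤ)] (K : Type) [Field K] [NumberField K] (Dt : Literature.NumberTheory.EllipticCurves.ModularForms.ModularParametrizationData W (W.conductorNorm ℤ)) (H : Literature.NumberTheory.EllipticCurves.HeegnerDatum (W.conductorNorm ℤ) (NumberField.discr K)) (ι : K →+* ℂ) (P : (W.baseChange K).toAffine.Point), W.HasCM → W.analyticRank = 1 → 5 ≤ p → Literature.NumberTheory.EllipticCurves.Rank1Residual.CMInert W p → ¬ Literature.NumberTheory.EllipticCurves.Rank1Residual.Good W p → Literature.NumberTheory.EllipticCurves.IsImaginaryQuadratic K → Literature.NumberTheory.EllipticCurves.SatisfiesHeegnerHypothesis (W.conductorNorm ℤ)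 K → 4 < (NumberField.discr K).natAbs → (∀ (L : Type) [Field L] [NumberField L], Module.finrank ℚ L = 4 → (∃ x : L, x ^ 2 = ((Literature.NumberTheory.EllipticCurves.Rank1Residual.cmFieldDiscrOfJ W.j : ℤ) : L)) → (∃ y : L, y ^ 2 = ((NumberField.discr K : ℤ) : L)) → ¬ p ∣ NumberField.classNumber L) → WeierstrassCurve.Affine.Point.map ι.toRatAlgHom P = Literature.NumberTheory.EllipticCurves.ModularForms.heegnerPointComplex Dt H → ¬ (p : ℤ) ∣ Dt.c → (W.baseChange K).mordellWeilRank = 1 → (W.baseChange K).ShaFinite → ¬ IsOfFinAddOrder P → (W.quadraticTwist (NumberField.discr K : ℚ)).entireLFunction 1 ≠ 0 → ∀ (κ : Literature.NumberTheory.EllipticCurves.ZpExtension K p), κ.IsAnticyclotomic → ∀ (γ : Field.absoluteGaloisGroup K) [Fact (κ.IsTopGenerator γ)] (𝔭 : IsDedekindDomain.HeightOneSpectrum (NumberField.RingOfIntegers K)) (h𝔭 : ((p : ℕ) : NumberField.RingOfIntegers K) ∈ 𝔭.asIdeal) (he : 𝔭.asIdeal.ramificationIdx (NumberField.RingOfIntegers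 ℚ) = 1) (hf : 𝔭.asIdeal.inertiaDeg (NumberField.RingOfIntegers ℚ) = 1) (𝔭' : IsDedekindDomain.HeightOneSpectrum (NumberField.RingOfIntegers K)) (_ : ((p : ℕ) : NumberField.RingOfIntegers K) ∈ 𝔭'.asIdeal) (_ : 𝔭' ≠ 𝔭), ∃ n : ℕ, Summit.BirchSwinnertonDyer.Rank1Residual.X11b.AcSelmer.XAc.HasCharValuationAt (W.baseChange K) p κ 𝔭' ∅ γ n ∧ (n : ℤ) ≤ (padicValNat p (Nat.card (AddCommGroup.primaryComponent (W.baseChange K).sha p)) : ℤ) + 2 * (Summit.BirchSwinnertonDyer.Rank1Residual.X11b.padicLogOrd W p (Summit.BirchSwinnertonDyer.Rank1Residual.X11b.embAt K p 𝔭 h𝔭 he hf) P - (padicValNat p (AddSubgroup.zmultiples P).index : ℤ)) + padicValNat p (Summit.BirchSwinnertonDyer.Rank1Residual.X11b.tamagawaProductSplit W K) := by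
  intro W _ _ p _ _ K _ _ Dt H ι P hCM _hr hp5 hin hbad hK hHN _hd4 _hadm _hP _hc hrank hSha hPinf
    _hLt κ hκ γ _ 𝔭 h𝔭 he hf 𝔭' h𝔭' _hne
  have hp2 : p ≠ 2 := by omega
  haveI : IsTotallyComplex K := hK.2
  have hadd : Addv W p := ⟨hbad, not_mult_of_hasCM W hCM p⟩
  have hivK : ∀ x : (W.baseChange K).toAffine.Point, p • x = 0 → x = 0 :=
    Transvection.forall_torsion_eq_zero_of_irr W p (X12.irr_of_not_cmRamified W p hp2 hin.1) K hK.1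
  have hpN : p ∣ W.conductorNorm ℤ := (W.dvd_conductorNorm_iff_not_hasGoodReductionAtPrime p).mpr hbad
  have hsplit : SplitsIn K p := hHN p Fact.out hpN
  obtain ⟨he', hf'⟩ := degreeOne_of_splitsIn hK.1 hsplit h𝔭'
  -- the count and the control count at the strict prime `𝔭′`
  obtain ⟨hfinSel, a, ha, hale⟩ := additiveSelmerCardBoundTorsion_of_rankOne W p K hadd hK hsplit
    hivK hrank hSha P hPinf 𝔭' h𝔭' he' hf'
  haveI := hfinSel
  obtain ⟨n, hn, hnle⟩ := exists_hasCharValuationAt_le_of_selmerCardBound_torsion (γ := γ) hK.1 hκ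
    h𝔭' he' hf' hsplit hpN ha
  refine ⟨n, hn, ?_⟩
  have hZ : (n : ℤ) + padicValNat p (tamagawaProductAbove W K p) ≤
      a + padicValNat p (tamagawaProductSplit W K) := by exact_mod_cast hnle
  -- the log read at `𝔭`
  rw [LogSymmetry.padicLogOrd_eq_of_finrank_eq_two W p hp2 hK.1 (embAt K p 𝔭 h𝔭 he hf)
    (embAt K p 𝔭' h𝔭' he' hf') hrank P hPinf] at hale
  linarith

/-- **C′ restated, variant A (facts FIRST), BY VALUE** — text = HOME/bsd-wall-bed-p3/C-OfGZK.sig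
(sha16 73c32ff8b8d2ca5e): `(∀ N W K, gross_zagier N W K) → (∀ N W K, kolyvagin N W K) →
hasEntireLFunction_rat →` the crux `ControlCMInertBadAdmOther` verbatim (the three antecedents are
conjuncts 1, 2, 5 of the route's `PublishedInputsBiquadratic`). Proof: the Heegner point is non-torsion
(Gross–Zagier with `ord_{s=1} L(E,s) = 1`, `L(E^{d_K},1) ≠ 0`), hence rank one and `Ш` finite
(Kolyvagin); then `c9B`. [cite: Gross1991, (1.1) and Thm. 1.3] [cite: Kolyvagin1990, Thm. A]
[cite: JetchevSkinnerWan2017, Thm. 3.3.1 and §7.4.1 (arXiv:1512.06894 pp. 11, 30)] -/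
theorem c9A :
    (∀ (N : ℕ) [NeZero N] (W : WeierstrassCurve ℚ) (K : Type) [Field K] [NumberField K], Literature.NumberTheory.EllipticCurves.gross_zagier N W K) → (∀ (N : ℕ) [NeZero N] (W : WeierstrassCurve ℚ) (K : Type) [Field K] [NumberField K], Literature.NumberTheory.EllipticCurves.kolyvagin N W K) → WeierstrassCurve.hasEntireLFunction_rat → ∀ (W : WeierstrassCurve ℚ) [W.IsElliptic] [W.IsGloballyMinimal] (p : ℕ) [Fact p.Prime] [NeZero (W.conductorNorm ℤ)] (K : Type) [Field K] [NumberField K] (Dt : Literature.NumberTheory.EllipticCurves.ModularForms.ModularParametrizationData W (W.conductorNorm ℤ)) (H : Literature.NumberTheory.EllipticCurves.HeegnerDatum (W.conductorNorm ℤ) (NumberField.discr K)) (ι : K →+* ℂ) (P : (W.baseChange K).toAffine.Point), W.HasCM → W.analyticRank = 1 → 5 ≤ p → Literature.NumberTheory.EllipticCurves.Rank1Residual.CMInert W p → ¬ Literature.NumberTheory.EllipticCurves.Rank1Residual.Good W p → Literature.NumberTheory.EllipticCurves.IsImaginaryQuadratic K → Literature.NumberTheory.EllipticCurves.SatisfiesHeegnerHypothesis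 (W.conductorNorm ℤ) K → 4 < (NumberField.discr K).natAbs → (∀ (L : Type) [Field L] [NumberField L], Module.finrank ℚ L = 4 → (∃ x : L, x ^ 2 = ((Literature.NumberTheory.EllipticCurves.Rank1Residual.cmFieldDiscrOfJ W.j : ℤ) : L)) → (∃ y : L, y ^ 2 = ((NumberField.discr K : ℤ) : L)) → ¬ p ∣ NumberField.classNumber L) → WeierstrassCurve.Affine.Point.map ι.toRatAlgHom P = Literature.NumberTheory.EllipticCurves.ModularForms.heegnerPointComplex Dt H → ¬ (p : ℤ) ∣ Dt.c → (W.quadraticTwist (NumberField.discr K : ℚ)).entireLFunction 1 ≠ 0 → ∀ (κ : Literature.NumberTheory.EllipticCurves.ZpExtension K p), κ.IsAnticyclotomic → ∀ (γ : Field.absoluteGaloisGroup K) [Fact (κ.IsTopGenerator γ)] (𝔭 : IsDedekindDomain.HeightOneSpectrum (NumberField.RingOfIntegers K)) (h𝔭 : ((p : ℕ) : NumberField.RingOfIntegers K) ∈ 𝔭.asIdeal) (he : 𝔭.asIdeal.ramificationIdx (NumberField.RingOfIntegers ℚ) = 1) (hf : 𝔭.asIdeal.inertiaDeg (NumberField.RingOfIntegers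 ℚ) = 1) (𝔭' : IsDedekindDomain.HeightOneSpectrum (NumberField.RingOfIntegers K)) (_ : ((p : ℕ) : NumberField.RingOfIntegers K) ∈ 𝔭'.asIdeal) (_ : 𝔭' ≠ 𝔭), ∃ n : ℕ, Summit.BirchSwinnertonDyer.Rank1Residual.X11b.AcSelmer.XAc.HasCharValuationAt (W.baseChange K) p κ 𝔭' ∅ γ n ∧ (n : ℤ) ≤ (padicValNat p (Nat.card (AddCommGroup.primaryComponent (W.baseChange K).sha p)) : ℤ) + 2 * (Summit.BirchSwinnertonDyer.Rank1Residual.X11b.padicLogOrd W p (Summit.BirchSwinnertonDyer.Rank1Residual.X11b.embAt K p 𝔭 h𝔭 he hf) P - (padicValNat p (AddSubgroup.zmultiples P).index : ℤ)) + padicValNat p (Summit.BirchSwinnertonDyer.Rank1Residual.X11b.tamagawaProductSplit W K) := by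
  intro hGZ hKo hmod W _ _ p _ _ K _ _ Dt H ι P hCM hr hp5 hin hbad hK hHN hd4 hadm hP hc hLt κ hκ γ _ 𝔭
    h𝔭 he hf 𝔭' h𝔭' hne
  have hPinf : ¬ IsOfFinAddOrder P :=
    not_isOfFinAddOrder_of_heegner_of_analyticRank_eq_one W (W.conductorNorm ℤ) K Dt H ι P
      (hGZ _ W K) hmod hr hK hHN hLt hP
  obtain ⟨hrank, hSha⟩ := hKo (W.conductorNorm ℤ) W K hK hHN ⟨Dt, H, ι, hP⟩ hPinf
  exact c9B W p K Dt H ι P hCM hr hp5 hin hbad hK hHN hd4 hadm hP hc hrank hSha hPinf hLt κ hκ γ 𝔭 h𝔭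
    he hf 𝔭' h𝔭' hne

end Summit.BirchSwinnertonDyer.BirchSwinnertonDyer.Theorems.ControlCMInertBadAdmOtherBody

end
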